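import Literature.NumberTheory.LFunctions.Zhang2022.DetectorShiftMomentsDD
import Literature.NumberTheory.LFunctions.Zhang2022.DetectorDoublingAtoms

/-!
# Zhang (2022), programme F-S3 (cell landau-siegel §E, registry E-102 HEAD 1): the four SOS moment identities at
# CONFLUENT nodes — the diagonal blocks `x = y ≠ a` and the anchor coincidences `x = a`, `y = a`, `x = y = a`

Y. Zhang, *Discrete mean estimates and the Landau–Siegel zero*, arXiv:2211.02515v1 [Zhang2022LandauSiegel] — an
unrefereed manuscript under adjudication. **WHAT THIS IS NOT: not a claim about Theorems 1–2 of arXiv:2211.02515,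
about Landau–Siegel zeros, or about Parity. «The programme SEARCHES and TYPES; no claim about Landau–Siegel zeros,
Theorems 1–2 of arXiv:2211.02515 or a repaired Margin232 until a kernel theorem says so.»**

Companion to the cell's `DetectorEntangledMomentSOS` (seat ls-barrier-p2; the four scalar identities (i)–(iv) of the
sum-of-squares decomposition of `π·Re Det.entangledMain`, cell note barrier/p2/R3a-ENTDBL-p2.md v2, there PROVED at
PAIRWISE-DISTINCT nodes `(a,x,y)`). The entangled block form sums over ALL ordered pairs of palette entries, so the
assembly also needs the identities at the CONFLUENT configurations, where the divided-difference moments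
`Det.ddM0/ddMs/ddMn` (`DetectorShiftMomentsDD`) take the confluent branches of `Det.dd2` (derivative data
`Det.ddBase'`, `Det.ddBase''`):

* Part 1 — the DIAGONAL `y = x ≠ a` (the blocks `(j,j)` of every palette): `momentSOS_*_diag` — the SAME four
  statement shapes as the distinct-node theorems with `y := x` (branch `h[a,x,x] = ((h(a)−h(x))/(a−x) − h′(x))/(a−x)`);
* Part 2 — the ANCHOR coincidences `x = a ≠ y` (`momentSOS_*_anchorLeft`), `y = a ≠ x` (`…_anchorRight`) and
  `x = y = a` (`…_anchorAll`): the coefficient `σ(a,c)` at `c = a` is its REMOVABLE value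
  `σ(a,a) = 1 + iπa − E_a²` (limit of `−[E_aE_c − (cE_cE_a⁻¹ − aE_aE_c⁻¹)/(c−a)]` as `c → a`), written out explicitly —
  NOTE that a definition of `σ` by the displayed quotient returns `−E_a²` at `c = a` under Lean's `x/0 = 0`, which is
  NOT the value the identity needs; branches `h[a,a,y]`, `h[a,y,a]`, `h[a,a,a] = h″(a)/2`.

Conventions: unit exponentials through the tree's `Det.halfUnit ![…] m = e^{iπ b_m/2}` (`DetectorDoublingAtoms`; equal
to `DetectorEntangledMomentSOS.halfExp (b m)` by `push_cast; ring` under `cexp`), `κ(c) = c·E_c`,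
`σ(a,c) = −[E_aE_c − (cE_cE_a⁻¹ − aE_aE_c⁻¹)/(c−a)]` expanded (the RHS of `sosSigma_eq`), `conj E = E⁻¹`; the moments
through `Det.ddM0`, `Det.ddMs = 2B·m₀ − m_b`, `Det.ddMn`. All statements float-checked against the tree definitions
(cell numerics HOME/num/num-2/conemix/sos_twin_float.py, un-cleared forms incl. `σ(a,a)`, ≤ 1e-15) and the distinct-node
forms verified EXACTLY as Laurent-polynomial identities (sosmom_exact.py). Proof: branch formula → `e^{iπ(B−·)}` as a
Laurent monomial in the `E`'s → `conj` pushed inside → `push_cast; field_simp; ring` (`π` a ring atom; one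
`linear_combination _ * I_sq` at the triple coincidence). Pure algebra; standard axioms; 0 defs; 0 named facts.
-/

noncomputable section

open Complex Real ComplexConjugate

namespace Literature.NumberTheory.LFunctions.Zhang2022

namespace Det

/-! ### Branches of the confluent divided difference and the phase monomials -/

/-- `h[p,q,q]`, `p ≠ q` (the tree's confluent branch; restated, the tree's copies are private). [folklore] -/
private theorem dd2_right_c (h h' h'' : ℝ → ℂ) {x y : ℝ} (hxy : x ≠ y) :
    dd2 h h' h'' x y y = ((h x - h y) / ((x - y : ℝ) : ℂ) - h' y) / ((x - y : ℝ) : ℂ) := by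
  rw [dd2, if_neg (fun hh => hh.2.1 rfl), if_neg (fun hh => hxy hh.1), if_neg hxy, if_pos rfl]

/-- `h[p,p,q]`, `p ≠ q`. [folklore] -/
private theorem dd2_left_c (h h' h'' : ℝ → ℂ) {x z : ℝ} (hxz : x ≠ z) :
    dd2 h h' h'' x x z = ((h z - h x) / ((z - x : ℝ) : ℂ) - h' x) / ((z - x : ℝ) : ℂ) := by
  rw [dd2, if_neg (fun hh => hh.1 rfl), if_neg (fun hh => hxz hh.2), if_pos rfl]

/-- `h[p,q,p]`, `p ≠ q`. [folklore] -/
private theorem dd2_outer_c (h h' h'' : ℝ → ℂ) {x y : ℝ} (hxy : x ≠ y) :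
    dd2 h h' h'' x y x = ((h y - h x) / ((y - x : ℝ) : ℂ) - h' x) / ((y - x : ℝ) : ℂ) := by
  rw [dd2, if_neg (fun hh => hh.2.2 rfl), if_neg (fun hh => hxy hh.1), if_neg hxy, if_neg (fun e => hxy e.symm)]

/-- `h[p,p,p] = h″(p)/2`. [folklore] -/
private theorem dd2_self_c (h h' h'' : ℝ → ℂ) (x : ℝ) : dd2 h h' h'' x x x = h'' x / 2 := by
  rw [dd2, if_neg (fun hh => hh.1 rfl), if_pos ⟨rfl, rfl⟩]

/-- `e^{iπ(B − a)} = E_x² E_a⁻¹`, `B = (a+x+x)/2`. [folklore] -/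
private theorem cexp_Bd_a (a x : ℝ) :
    cexp (I * π * (((a + x + x) / 2 - a : ℝ) : ℂ)) = halfUnit ![a, x, x] 1 * halfUnit ![a, x, x] 1 * (halfUnit ![a, x, x] 0)⁻¹ := by
  simp only [halfUnit, Matrix.cons_val_zero, Matrix.cons_val_one]
  rw [← Complex.exp_add, ← Complex.exp_neg, ← Complex.exp_add]
  congr 1
  push_cast
  ring

/-- `e^{iπ(B − x)} = E_a`, `B = (a+x+x)/2`. [folklore] -/
private theorem cexp_Bd_x (a x : ℝ) : cexp (I * π * (((a + x + x) / 2 - x : ℝ) : ℂ)) = halfUnit ![a, x, x] 0 := by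
  simp only [halfUnit, Matrix.cons_val_zero]
  congr 1
  push_cast
  ring

/-- `e^{iπ(B − a)} = E_y`, `B = (a+a+y)/2`. [folklore] -/
private theorem cexp_Bl_a (a y : ℝ) : cexp (I * π * (((a + a + y) / 2 - a : ℝ) : ℂ)) = halfUnit ![a, a, y] 2 := by
  simp only [halfUnit, Matrix.cons_val_two, Matrix.tail_cons, Matrix.head_cons]
  congr 1
  push_cast
  ring

/-- `e^{iπ(B − y)} = E_a² E_y⁻¹`, `B = (a+a+y)/2`. [folklore] -/
private theorem cexp_Bl_y (a y : ℝ) :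
    cexp (I * π * (((a + a + y) / 2 - y : ℝ) : ℂ)) = halfUnit ![a, a, y] 0 * halfUnit ![a, a, y] 0 * (halfUnit ![a, a, y] 2)⁻¹ := by
  simp only [halfUnit, Matrix.cons_val_zero, Matrix.cons_val_two, Matrix.tail_cons, Matrix.head_cons]
  rw [← Complex.exp_add, ← Complex.exp_neg, ← Complex.exp_add]
  congr 1
  push_cast
  ring

/-- `e^{iπ(B − a)} = E_x`, `B = (a+x+a)/2`. [folklore] -/
private theorem cexp_Br_a (a x : ℝ) : cexp (I * π * (((a + x + a) / 2 - a : ℝ) : ℂ)) = halfUnit ![a, x, a] 1 := by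
  simp only [halfUnit, Matrix.cons_val_one]
  congr 1
  push_cast
  ring

/-- `e^{iπ(B − x)} = E_a² E_x⁻¹`, `B = (a+x+a)/2`. [folklore] -/
private theorem cexp_Br_x (a x : ℝ) :
    cexp (I * π * (((a + x + a) / 2 - x : ℝ) : ℂ)) = halfUnit ![a, x, a] 0 * halfUnit ![a, x, a] 0 * (halfUnit ![a, x, a] 1)⁻¹ := by
  simp only [halfUnit, Matrix.cons_val_zero, Matrix.cons_val_one]
  rw [← Complex.exp_add, ← Complex.exp_neg, ← Complex.exp_add]
  congr 1
  push_cast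
  ring

/-- `e^{iπ(B − a)} = E_a`, `B = (a+a+a)/2`. [folklore] -/
private theorem cexp_Bs_a (a : ℝ) : cexp (I * π * (((a + a + a) / 2 - a : ℝ) : ℂ)) = halfUnit ![a, a, a] 0 := by
  simp only [halfUnit, Matrix.cons_val_zero]
  congr 1
  push_cast
  ring

/-! ### Part 1 — the diagonal `y = x ≠ a` -/

/-- **(iv) `γγ̄` on the diagonal `y = x ≠ a`** (same shape as the distinct-node theorem with `y := x`).
[cite: Zhang2022LandauSiegel, Prop 7.1 p.44 with (8.11)–(8.23)] -/
theorem momentSOS_gamma_gamma_diag (a x : ℝ) (hax : a ≠ x) :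
    ((x * x * (x + x) : ℝ) : ℂ) * (ddM0 ![a, x, x] - conj (ddM0 ![a, x, x]))
      - 2 * ((x * x : ℝ) : ℂ) * (ddMs ![a, x, x] - conj (ddMs ![a, x, x]))
      + ((x * x * (x - x) : ℝ) : ℂ) * (ddM0 ![a, x, x] + conj (ddM0 ![a, x, x]))
      + 2 * ((x : ℂ) * ddMn ![a, x, x] - (x : ℂ) * conj (ddMn ![a, x, x]))
    = 2 * (halfUnit ![a, x, x] 0 - (halfUnit ![a, x, x] 0)⁻¹) * ((x : ℂ) * halfUnit ![a, x, x] 1) * ((x : ℂ) * (halfUnit ![a, x, x] 1)⁻¹) := by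
  have hax' : (a : ℂ) - x ≠ 0 := sub_ne_zero.mpr (by exact_mod_cast hax)
  have hxa : (x : ℂ) - a ≠ 0 := sub_ne_zero.mpr (by exact_mod_cast (Ne.symm hax))
  simp only [ddM0, ddMs, ddMb, ddMn, ddOf, shiftB, Matrix.cons_val_zero, Matrix.cons_val_one, Matrix.cons_val_two,
    Matrix.head_cons, Matrix.tail_cons]
  repeat rw [dd2_right_c _ _ _ hax]
  simp only [ddBase, ddBase']
  rw [cexp_Bd_a, cexp_Bd_x]
  have hEa := halfUnit_ne_zero ![a, x, x] 0; have hEx := halfUnit_ne_zero ![a, x, x] 1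
  simp only [map_sub, map_mul, map_div₀, map_pow, map_inv₀, Complex.conj_ofReal, conj_halfUnit,
    Complex.conj_I, map_natCast, map_ofNat, inv_inv]
  push_cast
  field_simp
  ring

/-- **(ii) `ωγ̄` on the diagonal `y = x ≠ a`** (same shape as the distinct-node theorem with `y := x`).
[cite: Zhang2022LandauSiegel, Prop 7.1 p.44 with (8.11)–(8.23)] -/
theorem momentSOS_omega_gamma_diag (a x : ℝ) (hax : a ≠ x) :
    2 * (x : ℂ) * (ddMs ![a, x, x] - conj (ddMs ![a, x, x]))
      - ((x * (a + x + x) : ℝ) : ℂ) * (ddM0 ![a, x, x] - conj (ddM0 ![a, x, x]))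
      - 2 * ddMn ![a, x, x]
      + ((x * (a + x - x) : ℝ) : ℂ) * (ddM0 ![a, x, x] + conj (ddM0 ![a, x, x]))
    = 2 * -(halfUnit ![a, x, x] 0 * halfUnit ![a, x, x] 1 - ((x : ℂ) * (halfUnit ![a, x, x] 1 * (halfUnit ![a, x, x] 0)⁻¹) - (a : ℂ) * (halfUnit ![a, x, x] 0 * (halfUnit ![a, x, x] 1)⁻¹)) / ((x - a : ℝ) : ℂ)) * ((x : ℂ) * (halfUnit ![a, x, x] 1)⁻¹) := by
  have hax' : (a : ℂ) - x ≠ 0 := sub_ne_zero.mpr (by exact_mod_cast hax)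
  have hxa : (x : ℂ) - a ≠ 0 := sub_ne_zero.mpr (by exact_mod_cast (Ne.symm hax))
  simp only [ddM0, ddMs, ddMb, ddMn, ddOf, shiftB, Matrix.cons_val_zero, Matrix.cons_val_one, Matrix.cons_val_two,
    Matrix.head_cons, Matrix.tail_cons]
  repeat rw [dd2_right_c _ _ _ hax]
  simp only [ddBase, ddBase']
  rw [cexp_Bd_a, cexp_Bd_x]
  have hEa := halfUnit_ne_zero ![a, x, x] 0; have hEx := halfUnit_ne_zero ![a, x, x] 1
  simp only [map_sub, map_mul, map_div₀, map_pow, map_inv₀, Complex.conj_ofReal, conj_halfUnit,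
    Complex.conj_I, map_natCast, map_ofNat, inv_inv]
  push_cast
  field_simp
  ring

/-- **(iii) `γω̄` on the diagonal `y = x ≠ a`** (same shape as the distinct-node theorem with `y := x`).
[cite: Zhang2022LandauSiegel, Prop 7.1 p.44 with (8.11)–(8.23)] -/
theorem momentSOS_gamma_omega_diag (a x : ℝ) (hax : a ≠ x) :
    -(2 * (x : ℂ)) * (ddMs ![a, x, x] - conj (ddMs ![a, x, x]))
      + ((x * (a + x + x) : ℝ) : ℂ) * (ddM0 ![a, x, x] - conj (ddM0 ![a, x, x]))
      - 2 * conj (ddMn ![a, x, x])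
      + ((x * (a + x - x) : ℝ) : ℂ) * (ddM0 ![a, x, x] + conj (ddM0 ![a, x, x]))
    = 2 * -((halfUnit ![a, x, x] 0)⁻¹ * (halfUnit ![a, x, x] 1)⁻¹ - ((x : ℂ) * ((halfUnit ![a, x, x] 1)⁻¹ * halfUnit ![a, x, x] 0) - (a : ℂ) * ((halfUnit ![a, x, x] 0)⁻¹ * halfUnit ![a, x, x] 1)) / ((x - a : ℝ) : ℂ)) * ((x : ℂ) * halfUnit ![a, x, x] 1) := by
  have hax' : (a : ℂ) - x ≠ 0 := sub_ne_zero.mpr (by exact_mod_cast hax)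
  have hxa : (x : ℂ) - a ≠ 0 := sub_ne_zero.mpr (by exact_mod_cast (Ne.symm hax))
  simp only [ddM0, ddMs, ddMb, ddMn, ddOf, shiftB, Matrix.cons_val_zero, Matrix.cons_val_one, Matrix.cons_val_two,
    Matrix.head_cons, Matrix.tail_cons]
  repeat rw [dd2_right_c _ _ _ hax]
  simp only [ddBase, ddBase']
  rw [cexp_Bd_a, cexp_Bd_x]
  have hEa := halfUnit_ne_zero ![a, x, x] 0; have hEx := halfUnit_ne_zero ![a, x, x] 1
  simp only [map_sub, map_mul, map_div₀, map_pow, map_inv₀, Complex.conj_ofReal, conj_halfUnit,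
    Complex.conj_I, map_natCast, map_ofNat, inv_inv]
  push_cast
  field_simp
  ring

/-- **(i) `ωω̄` on the diagonal `y = x ≠ a`** (same shape as the distinct-node theorem with `y := x`).
[cite: Zhang2022LandauSiegel, Prop 7.1 p.44 with (8.11)–(8.23)] -/
theorem momentSOS_omega_omega_diag (a x : ℝ) (hax : a ≠ x) :
    (halfUnit ![a, x, x] 0 - (halfUnit ![a, x, x] 0)⁻¹) *
        (-((a + x + x : ℝ) : ℂ) * (ddM0 ![a, x, x] - conj (ddM0 ![a, x, x]))
          + 2 * (ddMs ![a, x, x] - conj (ddMs ![a, x, x]))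
          - ((x - x : ℝ) : ℂ) * (ddM0 ![a, x, x] + conj (ddM0 ![a, x, x])))
    = 2 * -(halfUnit ![a, x, x] 0 * halfUnit ![a, x, x] 1 - ((x : ℂ) * (halfUnit ![a, x, x] 1 * (halfUnit ![a, x, x] 0)⁻¹) - (a : ℂ) * (halfUnit ![a, x, x] 0 * (halfUnit ![a, x, x] 1)⁻¹)) / ((x - a : ℝ) : ℂ)) * -((halfUnit ![a, x, x] 0)⁻¹ * (halfUnit ![a, x, x] 1)⁻¹ - ((x : ℂ) * ((halfUnit ![a, x, x] 1)⁻¹ * halfUnit ![a, x, x] 0) - (a : ℂ) * ((halfUnit ![a, x, x] 0)⁻¹ * halfUnit ![a, x, x] 1)) / ((x - a : ℝ) : ℂ))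
      + (a : ℂ) * (halfUnit ![a, x, x] 0 + (halfUnit ![a, x, x] 0)⁻¹) * (ddM0 ![a, x, x] + conj (ddM0 ![a, x, x])) := by
  have hax' : (a : ℂ) - x ≠ 0 := sub_ne_zero.mpr (by exact_mod_cast hax)
  have hxa : (x : ℂ) - a ≠ 0 := sub_ne_zero.mpr (by exact_mod_cast (Ne.symm hax))
  simp only [ddM0, ddMs, ddMb, ddOf, shiftB, Matrix.cons_val_zero, Matrix.cons_val_one, Matrix.cons_val_two,
    Matrix.head_cons, Matrix.tail_cons]
  repeat rw [dd2_right_c _ _ _ hax]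
  simp only [ddBase, ddBase']
  rw [cexp_Bd_a, cexp_Bd_x]
  have hEa := halfUnit_ne_zero ![a, x, x] 0; have hEx := halfUnit_ne_zero ![a, x, x] 1
  simp only [map_sub, map_mul, map_div₀, map_pow, map_inv₀, Complex.conj_ofReal, conj_halfUnit,
    Complex.conj_I, map_natCast, map_ofNat, inv_inv]
  push_cast
  field_simp
  ring

/-! ### Part 2 — the anchor coincidences (`σ(a,a)` = the removable value `1 + iπa − E_a²`) -/

/-- **(iv) `γγ̄` at `x = a ≠ y`.** [cite: Zhang2022LandauSiegel, Prop 7.1 p.44 with (8.11)–(8.23)] -/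
theorem momentSOS_gamma_gamma_anchorLeft (a y : ℝ) (hay : a ≠ y) :
    ((a * y * (a + y) : ℝ) : ℂ) * (ddM0 ![a, a, y] - conj (ddM0 ![a, a, y]))
      - 2 * ((a * y : ℝ) : ℂ) * (ddMs ![a, a, y] - conj (ddMs ![a, a, y]))
      + ((a * y * (y - a) : ℝ) : ℂ) * (ddM0 ![a, a, y] + conj (ddM0 ![a, a, y]))
      + 2 * ((a : ℂ) * ddMn ![a, a, y] - (y : ℂ) * conj (ddMn ![a, a, y]))
    = 2 * (halfUnit ![a, a, y] 0 - (halfUnit ![a, a, y] 0)⁻¹) * ((a : ℂ) * halfUnit ![a, a, y] 0) * ((y : ℂ) * (halfUnit ![a, a, y] 2)⁻¹) := by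
  have hya : (y : ℂ) - a ≠ 0 := sub_ne_zero.mpr (by exact_mod_cast (Ne.symm hay))
  have hay' : (a : ℂ) - y ≠ 0 := sub_ne_zero.mpr (by exact_mod_cast hay)
  simp only [ddM0, ddMs, ddMb, ddMn, ddOf, shiftB, Matrix.cons_val_zero, Matrix.cons_val_one, Matrix.cons_val_two,
    Matrix.head_cons, Matrix.tail_cons]
  repeat rw [dd2_left_c _ _ _ hay]
  simp only [ddBase, ddBase']
  rw [cexp_Bl_a, cexp_Bl_y]
  have hEa := halfUnit_ne_zero ![a, a, y] 0; have hEy := halfUnit_ne_zero ![a, a, y] 2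
  simp only [map_sub, map_mul, map_div₀, map_pow, map_inv₀, Complex.conj_ofReal, conj_halfUnit,
    Complex.conj_I, map_natCast, map_ofNat, inv_inv]
  push_cast
  field_simp
  ring

/-- **(iv) `γγ̄` at `y = a ≠ x`.** [cite: Zhang2022LandauSiegel, Prop 7.1 p.44 with (8.11)–(8.23)] -/
theorem momentSOS_gamma_gamma_anchorRight (a x : ℝ) (hax : a ≠ x) :
    ((x * a * (x + a) : ℝ) : ℂ) * (ddM0 ![a, x, a] - conj (ddM0 ![a, x, a]))
      - 2 * ((x * a : ℝ) : ℂ) * (ddMs ![a, x, a] - conj (ddMs ![a, x, a]))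
      + ((x * a * (a - x) : ℝ) : ℂ) * (ddM0 ![a, x, a] + conj (ddM0 ![a, x, a]))
      + 2 * ((x : ℂ) * ddMn ![a, x, a] - (a : ℂ) * conj (ddMn ![a, x, a]))
    = 2 * (halfUnit ![a, x, a] 0 - (halfUnit ![a, x, a] 0)⁻¹) * ((x : ℂ) * halfUnit ![a, x, a] 1) * ((a : ℂ) * (halfUnit ![a, x, a] 0)⁻¹) := by
  have hxa : (x : ℂ) - a ≠ 0 := sub_ne_zero.mpr (by exact_mod_cast (Ne.symm hax))
  have hax' : (a : ℂ) - x ≠ 0 := sub_ne_zero.mpr (by exact_mod_cast hax)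
  simp only [ddM0, ddMs, ddMb, ddMn, ddOf, shiftB, Matrix.cons_val_zero, Matrix.cons_val_one, Matrix.cons_val_two,
    Matrix.head_cons, Matrix.tail_cons]
  repeat rw [dd2_outer_c _ _ _ hax]
  simp only [ddBase, ddBase']
  rw [cexp_Br_a, cexp_Br_x]
  have hEa := halfUnit_ne_zero ![a, x, a] 0; have hEx := halfUnit_ne_zero ![a, x, a] 1
  simp only [map_sub, map_mul, map_div₀, map_pow, map_inv₀, Complex.conj_ofReal, conj_halfUnit,
    Complex.conj_I, map_natCast, map_ofNat, inv_inv]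
  push_cast
  field_simp
  ring

/-- **(iv) `γγ̄` at `x = y = a`.** [cite: Zhang2022LandauSiegel, Prop 7.1 p.44 with (8.11)–(8.23)] -/
theorem momentSOS_gamma_gamma_anchorAll (a : ℝ) :
    ((a * a * (a + a) : ℝ) : ℂ) * (ddM0 ![a, a, a] - conj (ddM0 ![a, a, a]))
      - 2 * ((a * a : ℝ) : ℂ) * (ddMs ![a, a, a] - conj (ddMs ![a, a, a]))
      + ((a * a * (a - a) : ℝ) : ℂ) * (ddM0 ![a, a, a] + conj (ddM0 ![a, a, a]))
      + 2 * ((a : ℂ) * ddMn ![a, a, a] - (a : ℂ) * conj (ddMn ![a, a, a]))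
    = 2 * (halfUnit ![a, a, a] 0 - (halfUnit ![a, a, a] 0)⁻¹) * ((a : ℂ) * halfUnit ![a, a, a] 0) * ((a : ℂ) * (halfUnit ![a, a, a] 0)⁻¹) := by
  simp only [ddM0, ddMs, ddMb, ddMn, ddOf, shiftB, Matrix.cons_val_zero, Matrix.cons_val_one, Matrix.cons_val_two,
    Matrix.head_cons, Matrix.tail_cons]
  repeat rw [dd2_self_c]
  simp only [ddBase'']
  rw [cexp_Bs_a]
  have hEa := halfUnit_ne_zero ![a, a, a] 0
  simp only [map_sub, map_mul, map_div₀, map_pow, Complex.conj_ofReal, conj_halfUnit,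
    Complex.conj_I, map_natCast, map_ofNat, map_one]
  push_cast
  field_simp
  ring

/-- **(ii) `ωγ̄` at `x = a ≠ y`.** [cite: Zhang2022LandauSiegel, Prop 7.1 p.44 with (8.11)–(8.23)] -/
theorem momentSOS_omega_gamma_anchorLeft (a y : ℝ) (hay : a ≠ y) :
    2 * (y : ℂ) * (ddMs ![a, a, y] - conj (ddMs ![a, a, y]))
      - ((y * (a + a + y) : ℝ) : ℂ) * (ddM0 ![a, a, y] - conj (ddM0 ![a, a, y]))
      - 2 * ddMn ![a, a, y]
      + ((y * (a + a - y) : ℝ) : ℂ) * (ddM0 ![a, a, y] + conj (ddM0 ![a, a, y]))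
    = 2 * (1 + I * π * (a : ℂ) - halfUnit ![a, a, y] 0 * halfUnit ![a, a, y] 0) * ((y : ℂ) * (halfUnit ![a, a, y] 2)⁻¹) := by
  have hya : (y : ℂ) - a ≠ 0 := sub_ne_zero.mpr (by exact_mod_cast (Ne.symm hay))
  have hay' : (a : ℂ) - y ≠ 0 := sub_ne_zero.mpr (by exact_mod_cast hay)
  simp only [ddM0, ddMs, ddMb, ddMn, ddOf, shiftB, Matrix.cons_val_zero, Matrix.cons_val_one, Matrix.cons_val_two,
    Matrix.head_cons, Matrix.tail_cons]
  repeat rw [dd2_left_c _ _ _ hay]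
  simp only [ddBase, ddBase']
  rw [cexp_Bl_a, cexp_Bl_y]
  have hEa := halfUnit_ne_zero ![a, a, y] 0; have hEy := halfUnit_ne_zero ![a, a, y] 2
  simp only [map_sub, map_mul, map_div₀, map_pow, map_inv₀, Complex.conj_ofReal, conj_halfUnit,
    Complex.conj_I, map_natCast, map_ofNat, inv_inv]
  push_cast
  field_simp
  ring

/-- **(ii) `ωγ̄` at `y = a ≠ x`.** [cite: Zhang2022LandauSiegel, Prop 7.1 p.44 with (8.11)–(8.23)] -/
theorem momentSOS_omega_gamma_anchorRight (a x : ℝ) (hax : a ≠ x) :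
    2 * (a : ℂ) * (ddMs ![a, x, a] - conj (ddMs ![a, x, a]))
      - ((a * (a + x + a) : ℝ) : ℂ) * (ddM0 ![a, x, a] - conj (ddM0 ![a, x, a]))
      - 2 * ddMn ![a, x, a]
      + ((a * (a + x - a) : ℝ) : ℂ) * (ddM0 ![a, x, a] + conj (ddM0 ![a, x, a]))
    = 2 * -(halfUnit ![a, x, a] 0 * halfUnit ![a, x, a] 1 - ((x : ℂ) * (halfUnit ![a, x, a] 1 * (halfUnit ![a, x, a] 0)⁻¹) - (a : ℂ) * (halfUnit ![a, x, a] 0 * (halfUnit ![a, x, a] 1)⁻¹)) / ((x - a : ℝ) : ℂ)) * ((a : ℂ) * (halfUnit ![a, x, a] 0)⁻¹) := by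
  have hxa : (x : ℂ) - a ≠ 0 := sub_ne_zero.mpr (by exact_mod_cast (Ne.symm hax))
  have hax' : (a : ℂ) - x ≠ 0 := sub_ne_zero.mpr (by exact_mod_cast hax)
  simp only [ddM0, ddMs, ddMb, ddMn, ddOf, shiftB, Matrix.cons_val_zero, Matrix.cons_val_one, Matrix.cons_val_two,
    Matrix.head_cons, Matrix.tail_cons]
  repeat rw [dd2_outer_c _ _ _ hax]
  simp only [ddBase, ddBase']
  rw [cexp_Br_a, cexp_Br_x]
  have hEa := halfUnit_ne_zero ![a, x, a] 0; have hEx := halfUnit_ne_zero ![a, x, a] 1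
  simp only [map_sub, map_mul, map_div₀, map_pow, map_inv₀, Complex.conj_ofReal, conj_halfUnit,
    Complex.conj_I, map_natCast, map_ofNat, inv_inv]
  push_cast
  field_simp
  ring

/-- **(ii) `ωγ̄` at `x = y = a`.** [cite: Zhang2022LandauSiegel, Prop 7.1 p.44 with (8.11)–(8.23)] -/
theorem momentSOS_omega_gamma_anchorAll (a : ℝ) :
    2 * (a : ℂ) * (ddMs ![a, a, a] - conj (ddMs ![a, a, a]))
      - ((a * (a + a + a) : ℝ) : ℂ) * (ddM0 ![a, a, a] - conj (ddM0 ![a, a, a]))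
      - 2 * ddMn ![a, a, a]
      + ((a * (a + a - a) : ℝ) : ℂ) * (ddM0 ![a, a, a] + conj (ddM0 ![a, a, a]))
    = 2 * (1 + I * π * (a : ℂ) - halfUnit ![a, a, a] 0 * halfUnit ![a, a, a] 0) * ((a : ℂ) * (halfUnit ![a, a, a] 0)⁻¹) := by
  simp only [ddM0, ddMs, ddMb, ddMn, ddOf, shiftB, Matrix.cons_val_zero, Matrix.cons_val_one, Matrix.cons_val_two,
    Matrix.head_cons, Matrix.tail_cons]
  repeat rw [dd2_self_c]
  simp only [ddBase'']
  rw [cexp_Bs_a]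
  have hEa := halfUnit_ne_zero ![a, a, a] 0
  simp only [map_sub, map_mul, map_div₀, map_pow, Complex.conj_ofReal, conj_halfUnit,
    Complex.conj_I, map_natCast, map_ofNat, map_one]
  push_cast
  field_simp
  ring

/-- **(iii) `γω̄` at `x = a ≠ y`.** [cite: Zhang2022LandauSiegel, Prop 7.1 p.44 with (8.11)–(8.23)] -/
theorem momentSOS_gamma_omega_anchorLeft (a y : ℝ) (hay : a ≠ y) :
    -(2 * (a : ℂ)) * (ddMs ![a, a, y] - conj (ddMs ![a, a, y]))
      + ((a * (a + a + y) : ℝ) : ℂ) * (ddM0 ![a, a, y] - conj (ddM0 ![a, a, y]))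
      - 2 * conj (ddMn ![a, a, y])
      + ((a * (a + y - a) : ℝ) : ℂ) * (ddM0 ![a, a, y] + conj (ddM0 ![a, a, y]))
    = 2 * -((halfUnit ![a, a, y] 0)⁻¹ * (halfUnit ![a, a, y] 2)⁻¹ - ((y : ℂ) * ((halfUnit ![a, a, y] 2)⁻¹ * halfUnit ![a, a, y] 0) - (a : ℂ) * ((halfUnit ![a, a, y] 0)⁻¹ * halfUnit ![a, a, y] 2)) / ((y - a : ℝ) : ℂ)) * ((a : ℂ) * halfUnit ![a, a, y] 0) := by
  have hya : (y : ℂ) - a ≠ 0 := sub_ne_zero.mpr (by exact_mod_cast (Ne.symm hay))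
  have hay' : (a : ℂ) - y ≠ 0 := sub_ne_zero.mpr (by exact_mod_cast hay)
  simp only [ddM0, ddMs, ddMb, ddMn, ddOf, shiftB, Matrix.cons_val_zero, Matrix.cons_val_one, Matrix.cons_val_two,
    Matrix.head_cons, Matrix.tail_cons]
  repeat rw [dd2_left_c _ _ _ hay]
  simp only [ddBase, ddBase']
  rw [cexp_Bl_a, cexp_Bl_y]
  have hEa := halfUnit_ne_zero ![a, a, y] 0; have hEy := halfUnit_ne_zero ![a, a, y] 2
  simp only [map_sub, map_mul, map_div₀, map_pow, map_inv₀, Complex.conj_ofReal, conj_halfUnit,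
    Complex.conj_I, map_natCast, map_ofNat, inv_inv]
  push_cast
  field_simp
  ring

/-- **(iii) `γω̄` at `y = a ≠ x`.** [cite: Zhang2022LandauSiegel, Prop 7.1 p.44 with (8.11)–(8.23)] -/
theorem momentSOS_gamma_omega_anchorRight (a x : ℝ) (hax : a ≠ x) :
    -(2 * (x : ℂ)) * (ddMs ![a, x, a] - conj (ddMs ![a, x, a]))
      + ((x * (a + x + a) : ℝ) : ℂ) * (ddM0 ![a, x, a] - conj (ddM0 ![a, x, a]))
      - 2 * conj (ddMn ![a, x, a])
      + ((x * (a + a - x) : ℝ) : ℂ) * (ddM0 ![a, x, a] + conj (ddM0 ![a, x, a]))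
    = 2 * (1 - I * π * (a : ℂ) - (halfUnit ![a, x, a] 0)⁻¹ * (halfUnit ![a, x, a] 0)⁻¹) * ((x : ℂ) * halfUnit ![a, x, a] 1) := by
  have hxa : (x : ℂ) - a ≠ 0 := sub_ne_zero.mpr (by exact_mod_cast (Ne.symm hax))
  have hax' : (a : ℂ) - x ≠ 0 := sub_ne_zero.mpr (by exact_mod_cast hax)
  simp only [ddM0, ddMs, ddMb, ddMn, ddOf, shiftB, Matrix.cons_val_zero, Matrix.cons_val_one, Matrix.cons_val_two,
    Matrix.head_cons, Matrix.tail_cons]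
  repeat rw [dd2_outer_c _ _ _ hax]
  simp only [ddBase, ddBase']
  rw [cexp_Br_a, cexp_Br_x]
  have hEa := halfUnit_ne_zero ![a, x, a] 0; have hEx := halfUnit_ne_zero ![a, x, a] 1
  simp only [map_sub, map_mul, map_div₀, map_pow, map_inv₀, Complex.conj_ofReal, conj_halfUnit,
    Complex.conj_I, map_natCast, map_ofNat, inv_inv]
  push_cast
  field_simp
  ring

/-- **(iii) `γω̄` at `x = y = a`.** [cite: Zhang2022LandauSiegel, Prop 7.1 p.44 with (8.11)–(8.23)] -/
theorem momentSOS_gamma_omega_anchorAll (a : ℝ) :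
    -(2 * (a : ℂ)) * (ddMs ![a, a, a] - conj (ddMs ![a, a, a]))
      + ((a * (a + a + a) : ℝ) : ℂ) * (ddM0 ![a, a, a] - conj (ddM0 ![a, a, a]))
      - 2 * conj (ddMn ![a, a, a])
      + ((a * (a + a - a) : ℝ) : ℂ) * (ddM0 ![a, a, a] + conj (ddM0 ![a, a, a]))
    = 2 * (1 - I * π * (a : ℂ) - (halfUnit ![a, a, a] 0)⁻¹ * (halfUnit ![a, a, a] 0)⁻¹) * ((a : ℂ) * halfUnit ![a, a, a] 0) := by
  simp only [ddM0, ddMs, ddMb, ddMn, ddOf, shiftB, Matrix.cons_val_zero, Matrix.cons_val_one, Matrix.cons_val_two,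
    Matrix.head_cons, Matrix.tail_cons]
  repeat rw [dd2_self_c]
  simp only [ddBase'']
  rw [cexp_Bs_a]
  have hEa := halfUnit_ne_zero ![a, a, a] 0
  simp only [map_sub, map_mul, map_div₀, map_pow, Complex.conj_ofReal, conj_halfUnit,
    Complex.conj_I, map_natCast, map_ofNat, map_one]
  push_cast
  field_simp
  ring

/-- **(i) `ωω̄` at `x = a ≠ y`.** [cite: Zhang2022LandauSiegel, Prop 7.1 p.44 with (8.11)–(8.23)] -/
theorem momentSOS_omega_omega_anchorLeft (a y : ℝ) (hay : a ≠ y) :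
    (halfUnit ![a, a, y] 0 - (halfUnit ![a, a, y] 0)⁻¹) *
        (-((a + a + y : ℝ) : ℂ) * (ddM0 ![a, a, y] - conj (ddM0 ![a, a, y]))
          + 2 * (ddMs ![a, a, y] - conj (ddMs ![a, a, y]))
          - ((y - a : ℝ) : ℂ) * (ddM0 ![a, a, y] + conj (ddM0 ![a, a, y])))
    = 2 * (1 + I * π * (a : ℂ) - halfUnit ![a, a, y] 0 * halfUnit ![a, a, y] 0) * -((halfUnit ![a, a, y] 0)⁻¹ * (halfUnit ![a, a, y] 2)⁻¹ - ((y : ℂ) * ((halfUnit ![a, a, y] 2)⁻¹ * halfUnit ![a, a, y] 0) - (a : ℂ) * ((halfUnit ![a, a, y] 0)⁻¹ * halfUnit ![a, a, y] 2)) / ((y - a : ℝ) : ℂ))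
      + (a : ℂ) * (halfUnit ![a, a, y] 0 + (halfUnit ![a, a, y] 0)⁻¹) * (ddM0 ![a, a, y] + conj (ddM0 ![a, a, y])) := by
  have hya : (y : ℂ) - a ≠ 0 := sub_ne_zero.mpr (by exact_mod_cast (Ne.symm hay))
  have hay' : (a : ℂ) - y ≠ 0 := sub_ne_zero.mpr (by exact_mod_cast hay)
  simp only [ddM0, ddMs, ddMb, ddOf, shiftB, Matrix.cons_val_zero, Matrix.cons_val_one, Matrix.cons_val_two,
    Matrix.head_cons, Matrix.tail_cons]
  repeat rw [dd2_left_c _ _ _ hay]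
  simp only [ddBase, ddBase']
  rw [cexp_Bl_a, cexp_Bl_y]
  have hEa := halfUnit_ne_zero ![a, a, y] 0; have hEy := halfUnit_ne_zero ![a, a, y] 2
  simp only [map_sub, map_mul, map_div₀, map_pow, map_inv₀, Complex.conj_ofReal, conj_halfUnit,
    Complex.conj_I, map_natCast, map_ofNat, inv_inv]
  push_cast
  field_simp
  ring

/-- **(i) `ωω̄` at `y = a ≠ x`.** [cite: Zhang2022LandauSiegel, Prop 7.1 p.44 with (8.11)–(8.23)] -/
theorem momentSOS_omega_omega_anchorRight (a x : ℝ) (hax : a ≠ x) :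
    (halfUnit ![a, x, a] 0 - (halfUnit ![a, x, a] 0)⁻¹) *
        (-((a + x + a : ℝ) : ℂ) * (ddM0 ![a, x, a] - conj (ddM0 ![a, x, a]))
          + 2 * (ddMs ![a, x, a] - conj (ddMs ![a, x, a]))
          - ((a - x : ℝ) : ℂ) * (ddM0 ![a, x, a] + conj (ddM0 ![a, x, a])))
    = 2 * -(halfUnit ![a, x, a] 0 * halfUnit ![a, x, a] 1 - ((x : ℂ) * (halfUnit ![a, x, a] 1 * (halfUnit ![a, x, a] 0)⁻¹) - (a : ℂ) * (halfUnit ![a, x, a] 0 * (halfUnit ![a, x, a] 1)⁻¹)) / ((x - a : ℝ) : ℂ)) * (1 - I * π * (a : ℂ) - (halfUnit ![a, x, a] 0)⁻¹ * (halfUnit ![a, x, a] 0)⁻¹)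
      + (a : ℂ) * (halfUnit ![a, x, a] 0 + (halfUnit ![a, x, a] 0)⁻¹) * (ddM0 ![a, x, a] + conj (ddM0 ![a, x, a])) := by
  have hxa : (x : ℂ) - a ≠ 0 := sub_ne_zero.mpr (by exact_mod_cast (Ne.symm hax))
  have hax' : (a : ℂ) - x ≠ 0 := sub_ne_zero.mpr (by exact_mod_cast hax)
  simp only [ddM0, ddMs, ddMb, ddOf, shiftB, Matrix.cons_val_zero, Matrix.cons_val_one, Matrix.cons_val_two,
    Matrix.head_cons, Matrix.tail_cons]
  repeat rw [dd2_outer_c _ _ _ hax]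
  simp only [ddBase, ddBase']
  rw [cexp_Br_a, cexp_Br_x]
  have hEa := halfUnit_ne_zero ![a, x, a] 0; have hEx := halfUnit_ne_zero ![a, x, a] 1
  simp only [map_sub, map_mul, map_div₀, map_pow, map_inv₀, Complex.conj_ofReal, conj_halfUnit,
    Complex.conj_I, map_natCast, map_ofNat, inv_inv]
  push_cast
  field_simp
  ring

/-- **(i) `ωω̄` at `x = y = a`.** [cite: Zhang2022LandauSiegel, Prop 7.1 p.44 with (8.11)–(8.23)] -/
theorem momentSOS_omega_omega_anchorAll (a : ℝ) :
    (halfUnit ![a, a, a] 0 - (halfUnit ![a, a, a] 0)⁻¹) *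
        (-((a + a + a : ℝ) : ℂ) * (ddM0 ![a, a, a] - conj (ddM0 ![a, a, a]))
          + 2 * (ddMs ![a, a, a] - conj (ddMs ![a, a, a]))
          - ((a - a : ℝ) : ℂ) * (ddM0 ![a, a, a] + conj (ddM0 ![a, a, a])))
    = 2 * (1 + I * π * (a : ℂ) - halfUnit ![a, a, a] 0 * halfUnit ![a, a, a] 0) * (1 - I * π * (a : ℂ) - (halfUnit ![a, a, a] 0)⁻¹ * (halfUnit ![a, a, a] 0)⁻¹)
      + (a : ℂ) * (halfUnit ![a, a, a] 0 + (halfUnit ![a, a, a] 0)⁻¹) * (ddM0 ![a, a, a] + conj (ddM0 ![a, a, a])) := by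
  simp only [ddM0, ddMs, ddMb, ddOf, shiftB, Matrix.cons_val_zero, Matrix.cons_val_one, Matrix.cons_val_two,
    Matrix.head_cons, Matrix.tail_cons]
  repeat rw [dd2_self_c]
  simp only [ddBase'']
  rw [cexp_Bs_a]
  have hEa := halfUnit_ne_zero ![a, a, a] 0
  simp only [map_sub, map_mul, map_div₀, map_pow, Complex.conj_ofReal, conj_halfUnit,
    Complex.conj_I, map_natCast, map_ofNat, map_one]
  push_cast
  field_simp
  linear_combination (4 * (halfUnit ![a, a, a] 0) ^ 2 * (π : ℂ) ^ 2 * (a : ℂ) ^ 2) * Complex.I_sq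

end Det

end Literature.NumberTheory.LFunctions.Zhang2022
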